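import Summits.BirchSwinnertonDyer.BirchSwinnertonDyer.Theorems.GenusKolyvaginAtTwoMinimalTwinBSDTwoOddCutOfTranspositionWitness
import Summits.BirchSwinnertonDyer.BirchSwinnertonDyer.Theorems.GenusKolyvaginAtTwoMinimalTwinBSDTwoOddCutDepthZeroFrame
import Summits.BirchSwinnertonDyer.BirchSwinnertonDyer.Theorems.GenusKolyvaginAtTwoMinimalTwinBSDTwoTwinDoorClosedClass
import Summits.BirchSwinnertonDyer.BirchSwinnertonDyer.Theorems.GenusKolyvaginAtTwoMinimalTwinBSDTwoAnalyticTwin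
import Summits.BirchSwinnertonDyer.BirchSwinnertonDyer.Theorems.GenusKolyvaginAtTwoMinimalTwinBSDTwoDoorOpenDepthZeroOfBSD
import Summits.BirchSwinnertonDyer.BirchSwinnertonDyer.Theorems.GenusKolyvaginAtTwoMinimalTwinBSDTwoOddManinDatum
import HarnessLib

/-!
# Route `GenusKolyvaginAtTwo`, crux U₂ `MinimalTwinBSDTwo` (stmt-BirchSwinnertonDyer-22985), LINE 23 «twin_swap» — THE ANALYTIC BUDGET FRAME WITH ITS
# DOOR BIT (NVDOOR): U₂ on the odd habitat cut ⟸ WALL row 1 + PRINT + AU + Čes + Q2 + NVDOOR + WITNESS_{dc,≥2}, and NVDOOR's door clause is BSD-NECESSARY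

Seat `bsd-line-gk2-p2` g33 (PROVER seat 2/3, cell `bsd-f1-sign2`, LINE 23 holder), `--supports stmt-BirchSwinnertonDyer-22985 --as helper`.
THEOREMS ONLY (no definition, no named fact, no `sorry`).  BSD is NOT proved by any of this; U₂ is NOT proved; nothing is closed.

WHAT.  The Theorems-side form of the v2.11 skeleton offer (`Cruxes/MinimalTwinBSDTwo/Lines/twin_swap_v211_proposal_g33_gk2p2.lean`): the frame leaf of
LINE 23's on-cut branch is stated WITHOUT Heegner objects in its analytic part and WITHOUT a Manin clause off `v₂(N_W) ≥ 2` — NVDOOR: per `W`,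
«(4 ∣ N_W → ∃ odd-`c` datum) ∧ ∃ K (imaginary quadratic, `d_K` odd `≠ −3`, Heegner) with `L(W^{(d_K)},1) ≠ 0`, a globally minimal twin model INSIDE
THE GENUS BUDGET, and (door closed `#Sel₂(Wd) ≠ 1` ∨ [door open] `P(1) ∉ 2W(K[1])` for every odd-`c` datum and conductor-`1` Heegner datum on it)».
* §1 `frameDoor_of_budgetFrameDoor_of_facts` — per curve and frame: NVDOOR's data ⟹ v2.9's FRAME♮ data (an odd-`c` datum — p816794 on `4 ∤ N`; a
  conductor-`1` Heegner datum ON it — `exists_kolyvaginHeegnerData_one`; `P(1)` non-torsion — Gross–Zagier at analytic rank `1`; the door disjunct).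
* §2 `transpositionWitness_of_frameDoor_of_witnessDC` — per curve and frame: FRAME♮ data + the door-closed depth-`≥ 2` Kolyvagin leaf ⟹ an exact depth
  `M₀` and a transposition-deep witness (depth `0`: the frame, p812083; depth `1`: the swapped halving descent B2Q♭⁻± on the door class, p813942 /
  p814078 / p814724; depth `≥ 2`: the leaf) — the per-curve form of the v2.9 glue; then `bsdp_onOddCut_of_budgetFrameDoor_of_witnessDC_of_facts`
  (`BSD₂(W)`, the twin paid by WALL row 1) and ★ `minimalTwinBSDTwo_onOddCut_of_wall_of_budgetFrameDoorSupply_of_witnessSupply_of_facts` =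
  **U₂|cut ⟸ WALL row 1 + PRINT + AU + Čes + Q2 + NVDOOR-supply + WITNESS_{dc,≥2}-supply**.
* §3 `doorClause_of_bsdp_pair` — NECESSITY: at every budget frame (`K`, `L(W^{(d_K)},1) ≠ 0`, `Wd` in budget) of a curve on the cut with
  `#Sel₂(W) = 2`, `BSD₂(W) ∧ BSD₂(Wd)` FORCE NVDOOR's door clause (door-open ⟹ `P(1) ∉ 2W(K[1])` for every odd datum; p816017 run per datum).  So,
  granted BSD, NVDOOR's only non-automatic content is the EXISTENCE of a budget frame with `L(W^{(d_K)},1) ≠ 0` (twist non-vanishing inside a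
  Chebotarev-type budget class).

HONEST FRAMING.  CONDITIONAL on the displayed hypotheses; NVDOOR and WITNESS_{dc,≥2} are OPEN (research); nothing beyond print is claimed; BSD is NOT proved.

References: [Kolyvagin1989Izv] Thm. A, B_l; [GrossZagier1986] I.6.3, V.§2; [GrossLMS1991] §1, §4; [AbbesUllmo1996] Thm. A; [Cesnavicius2018] Thm. 1.2.
-/

set_option autoImplicit false
set_option linter.dupNamespace false -- `Summit.<P>.<Sub>` repeats `BirchSwinnertonDyer` (D-0017)

noncomputable section

open scoped Classical NumberField

namespace Summit.BirchSwinnertonDyer.BirchSwinnertonDyer.Theorems.GenusExact.TwinSwap.TwinAnnihilation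

open Literature.NumberTheory.EllipticCurves Literature.NumberTheory.GaloisRepresentations WeierstrassCurve NumberField
  IsDedekindDomain Field AddSubgroup Literature.NumberTheory.EllipticCurves.ModularForms
open Summit.BirchSwinnertonDyer.Rank1Residual
open Summit.BirchSwinnertonDyer.BirchSwinnertonDyer.Theses.GenusKolyvaginAtTwo (KolyvaginRelationAtTwo)
open Summit.BirchSwinnertonDyer.BirchSwinnertonDyer.Theorems.GenusExact.TwinSwap.Ledger.Line25
  (not_isOfFinAddOrder_derivedPoint_one_of_rankOne_of_lValue_ne_zero)
open Summit.BirchSwinnertonDyer.BirchSwinnertonDyer.Theorems.KolyvaginAtTwo (exists_exactTwoDepth)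

/-! ## §1 NVDOOR data ⟹ FRAME♮ data, per curve and frame -/

/-- **The analytic budget frame carries v2.9's frame data.**  For `W` globally minimal of analytic rank `1` with `ρ_{W,2^n}` onto (so `E[2]`
irreducible), an odd datum exists on `4 ∤ N_W` (p816794, mod Abbes–Ullmo + Česnavičius + modularity) and is ASSUMED on `4 ∣ N_W` (`h4`); at an
imaginary quadratic Heegner `K` with `L(W^{(d_K)},1) ≠ 0` a conductor-`1` Heegner datum on that datum EXISTS (`exists_kolyvaginHeegnerData_one`,
`phi_heegnerTau_mem_singularModuliField_holds`, `exists_dvd_sq_sub_discr_of_ncard_primesOver`) and its `P(1)` has infinite order (Gross–Zagier at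
analytic rank `1`); the door disjunct is transported.  CONDITIONAL; BSD is NOT proved. [cite: GrossZagier1986, Thm. I.6.3 with V.§2]
[cite: GrossLMS1991, §1 (1.1) and §4] [cite: AbbesUllmo1996, Thm. A] [cite: Cesnavicius2018, Thm. 1.2] -/
theorem frameDoor_of_budgetFrameDoor_of_facts
    (hAU : abbesUllmo_not_dvd_maninConstant_of_not_dvd_level) (hCes : cesnavicius_not_two_dvd_maninConstant_of_two_dvd_level)
    (hMP : nonempty_modularParametrizationData)
    (hGZ : ∀ (N : ℕ) [NeZero N] (W : WeierstrassCurve ℚ) (K : Type) [Field K] [NumberField K], gross_zagier N W K) (hmod : hasEntireLFunction_rat)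
    (W : WeierstrassCurve ℚ) [W.IsElliptic] [W.IsGloballyMinimal] [NeZero (W.conductorNorm ℤ)] (hr : W.analyticRank = 1)
    (hρ : ∀ n : ℕ, 0 < n → W.HasSurjectiveModNGaloisRep ((2 : ℤ) ^ n))
    (h4 : 4 ∣ W.conductorNorm ℤ → ∃ Dt : ModularParametrizationData W (W.conductorNorm ℤ), Odd Dt.c)
    (K : Type) [Field K] [NumberField K] (hK : IsImaginaryQuadratic K) (hH : SatisfiesHeegnerHypothesis (W.conductorNorm ℤ) K)
    (hLv : (W.quadraticTwist (NumberField.discr K : ℚ)).entireLFunction 1 ≠ 0)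
    (Wd : WeierstrassCurve ℚ) [Wd.IsElliptic]
    (hdoor : Nat.card (Wd.selmerGroup 2) ≠ 1 ∨
      ∀ (Dt : ModularParametrizationData W (W.conductorNorm ℤ)), Odd Dt.c → ∀ (β : ℤ) (ι : K →+* ℂ) (d₁ : KolyvaginHeegnerData Dt β ι 1),
        ¬ ∃ Q : (W.baseChange (ringClassField K ι 1)).toAffine.Point, (2 : ℤ) • Q = d₁.derivedPoint) :
    ∃ (Dt : ModularParametrizationData W (W.conductorNorm ℤ)) (β : ℤ) (ι : K →+* ℂ) (d₁ : KolyvaginHeegnerData Dt β ι 1),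
      Odd Dt.c ∧ ¬ IsOfFinAddOrder d₁.derivedPoint ∧
      ((¬ ∃ Q : (W.baseChange (ringClassField K ι 1)).toAffine.Point, (2 : ℤ) • Q = d₁.derivedPoint) ∨ Nat.card (Wd.selmerGroup 2) ≠ 1) := by
  have hDt : ∃ Dt : ModularParametrizationData W (W.conductorNorm ℤ), Odd Dt.c := by
    by_cases hN : 4 ∣ W.conductorNorm ℤ
    · exact h4 hN
    · exact OddManin.exists_datum_odd_c_conductor_of_forall_hasSurjectiveModNGaloisRep_of_not_four_dvd hAU hCes hMP W hρ hN
  obtain ⟨Dt, hc⟩ := hDt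
  obtain ⟨β, hβ⟩ : ∃ β : ℤ, (4 * (W.conductorNorm ℤ : ℕ) : ℤ) ∣ β ^ 2 - NumberField.discr K :=
    Literature.NumberTheory.QuadraticFields.Quadratic.exists_dvd_sq_sub_discr_of_ncard_primesOver hK.1 (NeZero.ne _) hH
  obtain ⟨ι⟩ : Nonempty (K →+* ℂ) := inferInstance
  obtain ⟨d₁⟩ := exists_kolyvaginHeegnerData_one (phi_heegnerTau_mem_singularModuliField_holds (W.conductorNorm ℤ) W K) hK Dt β ι hβ
  have hy : ¬ IsOfFinAddOrder d₁.derivedPoint :=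
    not_isOfFinAddOrder_derivedPoint_one_of_rankOne_of_lValue_ne_zero hmod W K (hGZ _ W K) hK hH hr hLv d₁
  refine ⟨Dt, β, ι, d₁, hc, hy, ?_⟩
  rcases hdoor with hdc | hprim
  · exact Or.inr hdc
  · exact Or.inl (hprim Dt hc β ι d₁)

/-! ## §2 FRAME♮ data + the door-closed depth-`≥ 2` Kolyvagin leaf ⟹ witness ⟹ `BSD₂(W)`; U₂ on the cut -/

/-- **Per curve and frame: the exact depth and a transposition-deep witness from the frame data and the door-closed depth-`≥ 2` leaf** (the v2.9
glue, one curve at a time).  Read the exact `2`-depth `M₀` of `P(1)` (`exists_exactTwoDepth`); at `M₀ = 0` the witness is `(1, d₁)` (p812083); at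
`M₀ ≥ 1` the depth-zero disjunct is refuted, so the door is CLOSED: at `M₀ = 1` the witness is MANUFACTURED by B2Q♭⁻± from the nonzero `4`-Selmer
class of the twin (p814724 / p814078), at `M₀ ≥ 2` it is the leaf's (`hWit`, asked only there).  Modulo Q2.  CONDITIONAL; BSD is NOT proved.
[cite: Kolyvagin1989Izv, Thm. B_l, §3] [cite: McCallumLMS1991, §5 Thm. 5.4] -/
theorem transpositionWitness_of_frameDoor_of_witnessDC (hQ2 : KolyvaginRelationAtTwo)
    (W : WeierstrassCurve ℚ) [W.IsElliptic] [W.IsGloballyMinimal] [NeZero (W.conductorNorm ℤ)] (hcm : ¬ W.HasCM)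
    (hr : W.analyticRank = 1) (hT : Odd W.tamagawaProduct) (v : HeightOneSpectrum (𝓞 ℚ)) (h2v : ((2 : ℕ) : 𝓞 ℚ) ∉ v.asIdeal)
    (hNv : ((W.conductorNorm ℤ : ℕ) : 𝓞 ℚ) ∈ v.asIdeal) (hmult : W.HasMultiplicativeReductionAt v)
    (hρ : ∀ n : ℕ, 0 < n → W.HasSurjectiveModNGaloisRep ((2 : ℤ) ^ n))
    (K : Type) [Field K] [NumberField K] (hK : IsImaginaryQuadratic K) (hodd : Odd (NumberField.discr K))
    (h3 : NumberField.discr K ≠ -3) (hH : SatisfiesHeegnerHypothesis (W.conductorNorm ℤ) K)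
    (Dt : ModularParametrizationData W (W.conductorNorm ℤ)) (β : ℤ) (ι : K →+* ℂ) (d₁ : KolyvaginHeegnerData Dt β ι 1)
    (hy : ¬ IsOfFinAddOrder d₁.derivedPoint)
    (Wd : WeierstrassCurve ℚ) [Wd.IsElliptic] (hWd : ∃ C : VariableChange ℚ, C • W.quadraticTwist (NumberField.discr K : ℚ) = Wd)
    (hdoor : (¬ ∃ Q : (W.baseChange (ringClassField K ι 1)).toAffine.Point, (2 : ℤ) • Q = d₁.derivedPoint) ∨ Nat.card (Wd.selmerGroup 2) ≠ 1)
    (hWit : ∀ (M₀ : ℕ), (∃ Q : (W.baseChange (ringClassField K ι 1)).toAffine.Point, ((2 ^ M₀ : ℕ) : ℤ) • Q = d₁.derivedPoint) →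
      (¬ ∃ Q : (W.baseChange (ringClassField K ι 1)).toAffine.Point, ((2 ^ (M₀ + 1) : ℕ) : ℤ) • Q = d₁.derivedPoint) → 2 ≤ M₀ →
      Nat.card (Wd.selmerGroup 2) ≠ 1 →
      ∃ (n : ℕ) (d : KolyvaginHeegnerData Dt β ι n), Squarefree n ∧
        (∀ ℓ ∈ n.primeFactors, Zhang2014.IsKolyvaginPrime (W.conductorNorm ℤ) W K 2 ℓ ∧ 2 ≤ Zhang2014.kolyvaginIndex W 2 ℓ ∧
          ∃ (v : HeightOneSpectrum (𝓞 ℚ)) (𝔓 : Ideal (absIntegers (𝓞 ℚ) ℚ)) (h : absoluteGaloisGroup ℚ),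
            ((ℓ : ℕ) : 𝓞 ℚ) ∈ v.asIdeal ∧ 𝔓 ∈ v.primesAbove ∧ IsArithFrobAt (𝓞 ℚ) h 𝔓 ∧ ∃ u : W.geomTorsion ((2 : ℕ) : ℤ), h • u ≠ u) ∧
        ¬ ∃ Q : (W.baseChange (ringClassField K ι n)).toAffine.Point, (2 : ℤ) • Q = d.derivedPoint) :
    ∃ M₀ : ℕ, (∃ Q : (W.baseChange (ringClassField K ι 1)).toAffine.Point, ((2 ^ M₀ : ℕ) : ℤ) • Q = d₁.derivedPoint) ∧
      (¬ ∃ Q : (W.baseChange (ringClassField K ι 1)).toAffine.Point, ((2 ^ (M₀ + 1) : ℕ) : ℤ) • Q = d₁.derivedPoint) ∧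
      ∃ (n : ℕ) (d : KolyvaginHeegnerData Dt β ι n), Squarefree n ∧
        (∀ ℓ ∈ n.primeFactors, Zhang2014.IsKolyvaginPrime (W.conductorNorm ℤ) W K 2 ℓ ∧ 2 ≤ Zhang2014.kolyvaginIndex W 2 ℓ ∧
          ∃ (v : HeightOneSpectrum (𝓞 ℚ)) (𝔓 : Ideal (absIntegers (𝓞 ℚ) ℚ)) (h : absoluteGaloisGroup ℚ),
            ((ℓ : ℕ) : 𝓞 ℚ) ∈ v.asIdeal ∧ 𝔓 ∈ v.primesAbove ∧ IsArithFrobAt (𝓞 ℚ) h 𝔓 ∧ ∃ u : W.geomTorsion ((2 : ℕ) : ℤ), h • u ≠ u) ∧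
        ¬ ∃ Q : (W.baseChange (ringClassField K ι n)).toAffine.Point, (2 : ℤ) • Q = d.derivedPoint := by
  haveI := (finiteDimensional_and_isGalois_ringClassField hK ι one_ne_zero).1
  haveI : NumberField (ringClassField K ι 1) := NumberField.of_module_finite K _
  haveI : (W.baseChange (ringClassField K ι 1)).IsElliptic := by rw [baseChange]; infer_instance
  haveI : Module.Finite ℤ (W.baseChange (ringClassField K ι 1)).toAffine.Point := by
    convert (W.baseChange (ringClassField K ι 1)).module_finite_point_holds
  obtain ⟨M₀, hdiv, hndiv⟩ := exists_exactTwoDepth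
    (A := (W.baseChange (ringClassField K ι 1)).toAffine.Point) (y := d₁.derivedPoint) (by convert hy)
  have hwn : W.rootNumber = -1 := TwinSwapBit.rootNumber_eq_neg_one_of_analyticRank_eq_one W hr Dt
  have hD0 : ((NumberField.discr K : ℤ) : ℚ) ≠ 0 := by exact_mod_cast NumberField.discr_ne_zero K
  haveI iT : (W.quadraticTwist ((NumberField.discr K : ℤ) : ℚ)).IsElliptic := W.isElliptic_quadraticTwist hD0
  have hs2 : W.HasSurjectiveModNGaloisRep 2 := by simpa using hρ 1 one_pos
  refine ⟨M₀, hdiv, hndiv, ?_⟩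
  rcases Nat.eq_zero_or_pos M₀ with h0 | hpos
  · -- depth 0: the witness is the frame
    have hndiv' : ¬ ∃ Q : (W.baseChange (ringClassField K ι 1)).toAffine.Point, (2 : ℤ) • Q = d₁.derivedPoint := by
      rw [h0] at hndiv
      simpa using hndiv
    exact transpositionWitness_of_depth_zero W K d₁ hndiv'
  · -- depth ≥ 1: `2 ∣ P(1)`, so the door is closed
    obtain ⟨k, rfl⟩ : ∃ k, M₀ = k + 1 := ⟨M₀ - 1, by omega⟩
    have h2dvd : ∃ Q : (W.baseChange (ringClassField K ι 1)).toAffine.Point, (2 : ℤ) • Q = d₁.derivedPoint := by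
      obtain ⟨Q, hQ⟩ := hdiv
      refine ⟨((2 ^ k : ℕ) : ℤ) • Q, ?_⟩
      rw [smul_smul, ← hQ]
      congr 1
      push_cast
      ring
    have hdoor' : Nat.card (Wd.selmerGroup 2) ≠ 1 := hdoor.resolve_left (not_not.mpr h2dvd)
    obtain ⟨Cd, hCd⟩ := hWd
    rcases Nat.lt_or_ge k 1 with hk | hk
    · -- depth exactly 1: B2Q♭⁻± manufactures the witness from the door bit
      obtain rfl : k = 0 := by omega
      obtain ⟨s₀, hs₀, hs0⟩ := exists_selmer_twist_four_ne_zero_of_natCard_selmerGroup_two_ne_one W K hK hs2 Cd hCd hdoor'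
      exact exists_transpositionWitness_of_depth_one_of_selmer_twist_ne_zero hQ2 W hcm hT v h2v hNv hmult K hK hodd h3 hH hρ Dt β ι d₁
        (by simpa using hndiv) hwn (1 + 1) le_rfl s₀ hs₀ hs0
    · -- depth ≥ 2: the Kolyvagin leaf
      exact hWit (k + 1) hdiv hndiv (by omega) hdoor'

/-- **`BSD₂(W)` per curve from an analytic budget frame with its door bit and the door-closed depth-`≥ 2` leaf** (§1 + the glue above + p811686 §4
per curve; the twin is non-CM of analytic rank `0`, so WALL row 1 pays `BSD₂(Wd)`).  Modulo Q2 + GZ + GZK + modularity + Milne + AU + Čes.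
CONDITIONAL; closes nothing; BSD is NOT proved. [cite: Kolyvagin1989Izv, Thm. A, Thm. B_l] [cite: GrossZagier1986, V.§2 (2.2)] -/
theorem bsdp_onOddCut_of_budgetFrameDoor_of_witnessDC_of_facts (hQ2 : KolyvaginRelationAtTwo)
    (hGZ : ∀ (N : ℕ) [NeZero N] (W : WeierstrassCurve ℚ) (K : Type) [Field K] [NumberField K], gross_zagier N W K)
    (hGZK : rank_eq_analyticRank_of_analyticRank_le_one) (hmod : hasEntireLFunction_rat)
    (hMilneC : Milne1972.bsdQuotient_baseChange_quadratic_anyModel) (hMP : nonempty_modularParametrizationData)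
    (hAU : abbesUllmo_not_dvd_maninConstant_of_not_dvd_level) (hCes : cesnavicius_not_two_dvd_maninConstant_of_two_dvd_level)
    (hS1 : ∀ (W : WeierstrassCurve ℚ) [W.IsElliptic] [W.IsGloballyMinimal], ¬ W.HasCM → W.analyticRank = 0 → BSDp W 2)
    (W : WeierstrassCurve ℚ) [W.IsElliptic] [W.IsGloballyMinimal] [NeZero (W.conductorNorm ℤ)] (hcm : ¬ W.HasCM)
    (hr : W.analyticRank = 1) (hSel : Nat.card (W.selmerGroup 2) = 2)
    (hT : Odd W.tamagawaProduct) (v : HeightOneSpectrum (𝓞 ℚ)) (h2v : ((2 : ℕ) : 𝓞 ℚ) ∉ v.asIdeal)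
    (hNv : ((W.conductorNorm ℤ : ℕ) : 𝓞 ℚ) ∈ v.asIdeal) (hmult : W.HasMultiplicativeReductionAt v)
    (hρ : ∀ n : ℕ, 0 < n → W.HasSurjectiveModNGaloisRep ((2 : ℤ) ^ n))
    (h4 : 4 ∣ W.conductorNorm ℤ → ∃ Dt : ModularParametrizationData W (W.conductorNorm ℤ), Odd Dt.c)
    (K : Type) [Field K] [NumberField K] (hK : IsImaginaryQuadratic K) (hodd : Odd (NumberField.discr K))
    (h3 : NumberField.discr K ≠ -3) (hH : SatisfiesHeegnerHypothesis (W.conductorNorm ℤ) K)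
    (hLv : (W.quadraticTwist (NumberField.discr K : ℚ)).entireLFunction 1 ≠ 0)
    (Wd : WeierstrassCurve ℚ) [Wd.IsElliptic] [Wd.IsGloballyMinimal]
    (hWd : ∃ C : VariableChange ℚ, C • W.quadraticTwist (NumberField.discr K : ℚ) = Wd)
    (hbudget : (W.Δ < 0 ∧ padicValNat 2 Wd.tamagawaProduct ≤ 1) ∨ padicValNat 2 Wd.tamagawaProduct = 0)
    (hdoor : Nat.card (Wd.selmerGroup 2) ≠ 1 ∨
      ∀ (Dt : ModularParametrizationData W (W.conductorNorm ℤ)), Odd Dt.c → ∀ (β : ℤ) (ι : K →+* ℂ) (d₁ : KolyvaginHeegnerData Dt β ι 1),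
        ¬ ∃ Q : (W.baseChange (ringClassField K ι 1)).toAffine.Point, (2 : ℤ) • Q = d₁.derivedPoint)
    (hWit : ∀ (Dt : ModularParametrizationData W (W.conductorNorm ℤ)), Odd Dt.c →
      ∀ (β : ℤ) (ι : K →+* ℂ) (d₁ : KolyvaginHeegnerData Dt β ι 1), ¬ IsOfFinAddOrder d₁.derivedPoint →
      ∀ (M₀ : ℕ), (∃ Q : (W.baseChange (ringClassField K ι 1)).toAffine.Point, ((2 ^ M₀ : ℕ) : ℤ) • Q = d₁.derivedPoint) →
        (¬ ∃ Q : (W.baseChange (ringClassField K ι 1)).toAffine.Point, ((2 ^ (M₀ + 1) : ℕ) : ℤ) • Q = d₁.derivedPoint) → 2 ≤ M₀ →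
        Nat.card (Wd.selmerGroup 2) ≠ 1 →
        ∃ (n : ℕ) (d : KolyvaginHeegnerData Dt β ι n), Squarefree n ∧
          (∀ ℓ ∈ n.primeFactors, Zhang2014.IsKolyvaginPrime (W.conductorNorm ℤ) W K 2 ℓ ∧ 2 ≤ Zhang2014.kolyvaginIndex W 2 ℓ ∧
            ∃ (v : HeightOneSpectrum (𝓞 ℚ)) (𝔓 : Ideal (absIntegers (𝓞 ℚ) ℚ)) (h : absoluteGaloisGroup ℚ),
              ((ℓ : ℕ) : 𝓞 ℚ) ∈ v.asIdeal ∧ 𝔓 ∈ v.primesAbove ∧ IsArithFrobAt (𝓞 ℚ) h 𝔓 ∧ ∃ u : W.geomTorsion ((2 : ℕ) : ℤ), h • u ≠ u) ∧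
          ¬ ∃ Q : (W.baseChange (ringClassField K ι n)).toAffine.Point, (2 : ℤ) • Q = d.derivedPoint) :
    BSDp W 2 := by
  obtain ⟨Dt, β, ι, d₁, hc, hy, hdoor₁⟩ := frameDoor_of_budgetFrameDoor_of_facts hAU hCes hMP hGZ hmod W hr hρ h4 K hK hH hLv Wd hdoor
  obtain ⟨M₀, hdiv, hndiv, n, d, hn, hdeep, hPn⟩ := transpositionWitness_of_frameDoor_of_witnessDC hQ2 W hcm hr hT v h2v hNv hmult hρ K hK hodd h3
    hH Dt β ι d₁ hy Wd hWd hdoor₁ (hWit Dt hc β ι d₁ hy)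
  -- the twin model is non-CM (same `j`) of analytic rank `0` (`L(W^{(d_K)},1) ≠ 0`), so `BSD₂(Wd)` by S1′
  obtain ⟨Cd, hCd⟩ := hWd
  have hD0 : (NumberField.discr K : ℚ) ≠ 0 := by exact_mod_cast NumberField.discr_ne_zero K
  haveI hTell : (W.quadraticTwist (NumberField.discr K : ℚ)).IsElliptic := W.isElliptic_quadraticTwist hD0
  subst hCd
  have hcmd : ¬ (Cd • W.quadraticTwist (NumberField.discr K : ℚ)).HasCM := by
    rw [hasCM_iff_of_j_eq (((W.quadraticTwist (NumberField.discr K : ℚ)).variableChange_j Cd).trans (W.j_quadraticTwist hD0))]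
    exact hcm
  have hrd : (Cd • W.quadraticTwist (NumberField.discr K : ℚ)).analyticRank = 0 := by
    rw [analyticRank_smul]
    exact ((W.quadraticTwist (NumberField.discr K : ℚ)).analyticRank_eq_zero_iff_holds (hmod _)).mpr hLv
  have hBSDd : BSDp (Cd • W.quadraticTwist (NumberField.discr K : ℚ)) 2 := hS1 _ hcmd hrd
  exact bsdp_onOddCut_of_transpositionWitness_of_facts hQ2 hGZ hGZK hmod hMilneC W hcm hr hSel hT v h2v hNv hmult hρ K hK hodd h3 hH Dt hc β ι d₁ hy
    M₀ hdiv hndiv (Cd • W.quadraticTwist (NumberField.discr K : ℚ)) ⟨Cd, rfl⟩ hbudget hBSDd n d hn hdeep hPn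

/-- ★ **U₂ ON THE WHOLE ODD HABITAT CUT ⟸ WALL row 1 + PRINT + Abbes–Ullmo + Česnavičius + Q2 + NVDOOR-supply + WITNESS_{dc,≥2}-supply** — the census
form of LINE 23's on-cut branch with the frame leaf free of Heegner objects and of the Manin constant off `v₂(N_W) ≥ 2`.  NVDOOR-supply (`hNV`): per `W`
on the cut, «(4 ∣ N_W → ∃ odd datum) ∧ ∃ K Heegner (d_K odd ≠ −3), L(W^{(d_K)},1) ≠ 0, a globally minimal twin model in the genus budget, door clause».
WITNESS-supply (`hWit`): the door-closed depth-`≥ 2` Kolyvagin leaf in K₄'s `∀` shape (v2.9's WITNESS_{dc,≥2} verbatim).  Both OPEN; CONDITIONAL;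
closes nothing; BSD is NOT proved. [cite: Kolyvagin1989Izv, Thm. A, Thm. B_l] [cite: GrossZagier1986, V.§2 (2.2)] [cite: AbbesUllmo1996, Thm. A]
[cite: Cesnavicius2018, Thm. 1.2] -/
theorem minimalTwinBSDTwo_onOddCut_of_wall_of_budgetFrameDoorSupply_of_witnessSupply_of_facts (hQ2 : KolyvaginRelationAtTwo)
    (hGZ : ∀ (N : ℕ) [NeZero N] (W : WeierstrassCurve ℚ) (K : Type) [Field K] [NumberField K], gross_zagier N W K)
    (hGZK : rank_eq_analyticRank_of_analyticRank_le_one) (hmod : hasEntireLFunction_rat)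
    (hMilneC : Milne1972.bsdQuotient_baseChange_quadratic_anyModel) (hMP : nonempty_modularParametrizationData)
    (hAU : abbesUllmo_not_dvd_maninConstant_of_not_dvd_level) (hCes : cesnavicius_not_two_dvd_maninConstant_of_two_dvd_level)
    (hS1 : ∀ (W : WeierstrassCurve ℚ) [W.IsElliptic] [W.IsGloballyMinimal], ¬ W.HasCM → W.analyticRank = 0 → BSDp W 2)
    (hNV : ∀ (W : WeierstrassCurve ℚ) [W.IsElliptic] [W.IsGloballyMinimal] [NeZero (W.conductorNorm ℤ)],
      ¬ W.HasCM → W.analyticRank = 1 → Nat.card (W.selmerGroup 2) = 2 → Odd W.tamagawaProduct →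
      (∀ n : ℕ, 0 < n → W.HasSurjectiveModNGaloisRep ((2 : ℤ) ^ n)) →
      (∃ v : HeightOneSpectrum (𝓞 ℚ), ((2 : ℕ) : 𝓞 ℚ) ∉ v.asIdeal ∧ ((W.conductorNorm ℤ : ℕ) : 𝓞 ℚ) ∈ v.asIdeal ∧ W.HasMultiplicativeReductionAt v) →
      (4 ∣ W.conductorNorm ℤ → ∃ Dt : ModularParametrizationData W (W.conductorNorm ℤ), Odd Dt.c) ∧
      ∃ (K : Type) (_ : Field K) (_ : NumberField K), IsImaginaryQuadratic K ∧ Odd (NumberField.discr K) ∧ NumberField.discr K ≠ -3 ∧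
        SatisfiesHeegnerHypothesis (W.conductorNorm ℤ) K ∧ (W.quadraticTwist (NumberField.discr K : ℚ)).entireLFunction 1 ≠ 0 ∧
        ∃ (Wd : WeierstrassCurve ℚ) (_ : Wd.IsElliptic) (_ : Wd.IsGloballyMinimal),
          (∃ C : VariableChange ℚ, C • W.quadraticTwist (NumberField.discr K : ℚ) = Wd) ∧
            ((W.Δ < 0 ∧ padicValNat 2 Wd.tamagawaProduct ≤ 1) ∨ padicValNat 2 Wd.tamagawaProduct = 0) ∧
            (Nat.card (Wd.selmerGroup 2) ≠ 1 ∨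
              ∀ (Dt : ModularParametrizationData W (W.conductorNorm ℤ)), Odd Dt.c → ∀ (β : ℤ) (ι : K →+* ℂ) (d₁ : KolyvaginHeegnerData Dt β ι 1),
                ¬ ∃ Q : (W.baseChange (ringClassField K ι 1)).toAffine.Point, (2 : ℤ) • Q = d₁.derivedPoint))
    (hWit : ∀ (W : WeierstrassCurve ℚ) [W.IsElliptic] [W.IsGloballyMinimal] [NeZero (W.conductorNorm ℤ)],
      ¬ W.HasCM → W.analyticRank = 1 → Nat.card (W.selmerGroup 2) = 2 → Odd W.tamagawaProduct →
      (∀ n : ℕ, 0 < n → W.HasSurjectiveModNGaloisRep ((2 : ℤ) ^ n)) →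
      (∃ v : HeightOneSpectrum (𝓞 ℚ), ((2 : ℕ) : 𝓞 ℚ) ∉ v.asIdeal ∧ ((W.conductorNorm ℤ : ℕ) : 𝓞 ℚ) ∈ v.asIdeal ∧ W.HasMultiplicativeReductionAt v) →
      ∀ (K : Type) [Field K] [NumberField K], IsImaginaryQuadratic K → Odd (NumberField.discr K) → NumberField.discr K ≠ -3 →
        SatisfiesHeegnerHypothesis (W.conductorNorm ℤ) K →
      ∀ (Dt : ModularParametrizationData W (W.conductorNorm ℤ)), Odd Dt.c →
      ∀ (β : ℤ) (ι : K →+* ℂ) (d₁ : KolyvaginHeegnerData Dt β ι 1), ¬ IsOfFinAddOrder d₁.derivedPoint →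
      ∀ (M₀ : ℕ), (∃ Q : (W.baseChange (ringClassField K ι 1)).toAffine.Point, ((2 ^ M₀ : ℕ) : ℤ) • Q = d₁.derivedPoint) →
        (¬ ∃ Q : (W.baseChange (ringClassField K ι 1)).toAffine.Point, ((2 ^ (M₀ + 1) : ℕ) : ℤ) • Q = d₁.derivedPoint) → 2 ≤ M₀ →
      ∀ (Wd : WeierstrassCurve ℚ) [Wd.IsElliptic] [Wd.IsGloballyMinimal],
        (∃ C : VariableChange ℚ, C • W.quadraticTwist (NumberField.discr K : ℚ) = Wd) →
        ((W.Δ < 0 ∧ padicValNat 2 Wd.tamagawaProduct ≤ 1) ∨ padicValNat 2 Wd.tamagawaProduct = 0) → Nat.card (Wd.selmerGroup 2) ≠ 1 →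
        ∃ (n : ℕ) (d : KolyvaginHeegnerData Dt β ι n), Squarefree n ∧
          (∀ ℓ ∈ n.primeFactors, Zhang2014.IsKolyvaginPrime (W.conductorNorm ℤ) W K 2 ℓ ∧ 2 ≤ Zhang2014.kolyvaginIndex W 2 ℓ ∧
            ∃ (v : HeightOneSpectrum (𝓞 ℚ)) (𝔓 : Ideal (absIntegers (𝓞 ℚ) ℚ)) (h : absoluteGaloisGroup ℚ),
              ((ℓ : ℕ) : 𝓞 ℚ) ∈ v.asIdeal ∧ 𝔓 ∈ v.primesAbove ∧ IsArithFrobAt (𝓞 ℚ) h 𝔓 ∧ ∃ u : W.geomTorsion ((2 : ℕ) : ℤ), h • u ≠ u) ∧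
          ¬ ∃ Q : (W.baseChange (ringClassField K ι n)).toAffine.Point, (2 : ℤ) • Q = d.derivedPoint) :
    ∀ (W : WeierstrassCurve ℚ) [W.IsElliptic] [W.IsGloballyMinimal] [NeZero (W.conductorNorm ℤ)],
      ¬ W.HasCM → W.analyticRank = 1 → Nat.card (W.selmerGroup 2) = 2 → Odd W.tamagawaProduct →
      (∀ n : ℕ, 0 < n → W.HasSurjectiveModNGaloisRep ((2 : ℤ) ^ n)) →
      (∃ v : HeightOneSpectrum (𝓞 ℚ), ((2 : ℕ) : 𝓞 ℚ) ∉ v.asIdeal ∧ ((W.conductorNorm ℤ : ℕ) : 𝓞 ℚ) ∈ v.asIdeal ∧ W.HasMultiplicativeReductionAt v) →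
      BSDp W 2 := by
  intro W _ _ _ hcm hr hSel hT hρ hv
  obtain ⟨h4, K, iF, iN, hK, hodd, h3, hH, hLv, Wd, iE, iM, hWd, hbudget, hdoor⟩ := hNV W hcm hr hSel hT hρ hv
  have hWit' := hWit W hcm hr hSel hT hρ hv K hK hodd h3 hH
  obtain ⟨v, h2v, hNv, hmult⟩ := hv
  exact bsdp_onOddCut_of_budgetFrameDoor_of_witnessDC_of_facts hQ2 hGZ hGZK hmod hMilneC hMP hAU hCes hS1 W hcm hr hSel hT v h2v hNv hmult hρ h4 K
    hK hodd h3 hH hLv Wd hWd hbudget hdoor (fun Dt hc β ι d₁ hy M₀ hdiv hndiv hM₀ hdc ↦ hWit' Dt hc β ι d₁ hy M₀ hdiv hndiv hM₀ Wd hWd hbudget hdc)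

/-! ## §3 NECESSITY: BSD₂ of the pair forces NVDOOR's door clause at every budget frame -/

/-- **NVDOOR's door clause is BSD-necessary.**  At every budget frame (`K` imaginary quadratic, `d_K` odd `≠ −3`, Heegner, `L(W^{(d_K)},1) ≠ 0`, a
globally minimal twin model `Wd` in the genus budget) of a curve of analytic rank `1` with `#Sel₂(W) = 2`, `C(W)` odd and `ρ̄_{W,2}` onto:
`BSD₂(W) ∧ BSD₂(Wd)` imply «`#Sel₂(Wd) ≠ 1` ∨ `P(1) ∉ 2W(K[1])` for every odd datum and conductor-`1` Heegner datum» (p816017's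
`depth_eq_zero_of_doorOpen_of_bsdp_pair` run per datum, the exact depth from `exists_exactTwoDepth`, non-torsion from Gross–Zagier).  So, granted BSD,
NVDOOR's content beyond its door clause is the EXISTENCE of a budget frame with non-vanishing twisted central value.  Modulo GZ + GZK + modularity + Milne.
CONDITIONAL; BSD is NOT proved. [cite: GrossZagier1986, V.§2 (2.2)] [cite: Kolyvagin1989Izv, Thm. A] -/
theorem doorClause_of_bsdp_pair
    (hGZ : ∀ (N : ℕ) [NeZero N] (W : WeierstrassCurve ℚ) (K : Type) [Field K] [NumberField K], gross_zagier N W K)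
    (hGZK : rank_eq_analyticRank_of_analyticRank_le_one) (hmod : hasEntireLFunction_rat)
    (hMilneC : Milne1972.bsdQuotient_baseChange_quadratic_anyModel)
    (W : WeierstrassCurve ℚ) [W.IsElliptic] [W.IsGloballyMinimal] [NeZero (W.conductorNorm ℤ)]
    (hr : W.analyticRank = 1) (hSel : Nat.card (W.selmerGroup 2) = 2) (hT : Odd W.tamagawaProduct) (hs2 : W.HasSurjectiveModNGaloisRep 2)
    (K : Type) [Field K] [NumberField K] (hK : IsImaginaryQuadratic K) (hodd : Odd (NumberField.discr K))
    (h3 : NumberField.discr K ≠ -3) (hH : SatisfiesHeegnerHypothesis (W.conductorNorm ℤ) K)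
    (hLv : (W.quadraticTwist (NumberField.discr K : ℚ)).entireLFunction 1 ≠ 0)
    (Wd : WeierstrassCurve ℚ) [Wd.IsElliptic] [Wd.IsGloballyMinimal] (hWd : ∃ C : VariableChange ℚ, C • W.quadraticTwist (NumberField.discr K : ℚ) = Wd)
    (hbudget : (W.Δ < 0 ∧ padicValNat 2 Wd.tamagawaProduct ≤ 1) ∨ padicValNat 2 Wd.tamagawaProduct = 0) (hBW : BSDp W 2) (hBd : BSDp Wd 2) :
    Nat.card (Wd.selmerGroup 2) ≠ 1 ∨
      ∀ (Dt : ModularParametrizationData W (W.conductorNorm ℤ)), Odd Dt.c → ∀ (β : ℤ) (ι : K →+* ℂ) (d₁ : KolyvaginHeegnerData Dt β ι 1),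
        ¬ ∃ Q : (W.baseChange (ringClassField K ι 1)).toAffine.Point, (2 : ℤ) • Q = d₁.derivedPoint := by
  by_cases hdc : Nat.card (Wd.selmerGroup 2) ≠ 1
  · exact Or.inl hdc
  right
  rw [not_ne_iff] at hdc
  intro Dt hc β ι d₁
  obtain ⟨Cd, hCd⟩ := hWd
  have hy : ¬ IsOfFinAddOrder d₁.derivedPoint :=
    not_isOfFinAddOrder_derivedPoint_one_of_rankOne_of_lValue_ne_zero hmod W K (hGZ _ W K) hK hH hr hLv d₁
  haveI := (finiteDimensional_and_isGalois_ringClassField hK ι one_ne_zero).1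
  haveI : NumberField (ringClassField K ι 1) := NumberField.of_module_finite K _
  haveI : (W.baseChange (ringClassField K ι 1)).IsElliptic := by rw [baseChange]; infer_instance
  haveI : Module.Finite ℤ (W.baseChange (ringClassField K ι 1)).toAffine.Point := by
    convert (W.baseChange (ringClassField K ι 1)).module_finite_point_holds
  obtain ⟨M₀, hdiv, hndiv⟩ := exists_exactTwoDepth
    (A := (W.baseChange (ringClassField K ι 1)).toAffine.Point) (y := d₁.derivedPoint) (by convert hy)
  have hM0 : M₀ = 0 := depth_eq_zero_of_doorOpen_of_bsdp_pair hGZ hGZK hmod hMilneC W hr hSel hT hs2 K hK hodd h3 hH Dt hc β ι d₁ hy M₀ hdiv hndiv Wd Cd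
    hCd hdc hbudget hBW hBd
  subst hM0
  simpa using hndiv

end Summit.BirchSwinnertonDyer.BirchSwinnertonDyer.Theorems.GenusExact.TwinSwap.TwinAnnihilation

end
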